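import Mathlib
import HarnessLib
import Literature.MathematicalPhysics.QuantumLattice.KohnLuttinger
import Summits.HubbardSuperconductivity.HubbardSuperconductivity.Theorems.ChiralWindowCwChannelInfContinuousFilling
import Summits.HubbardSuperconductivity.HubbardSuperconductivity.Theorems.KLProgrammeMuOfDopingWindowFillingLower
import Summits.HubbardSuperconductivity.HubbardSuperconductivity.Theorems.KLProgrammeMuOfDopingWindowFillingUpper

/-!
# Route `KLProgramme` — support item `MuOfDopingWindow` (stmt-HubbardSuperconductivity-19939, S0)

**The free-band chemical potentials of the doping window lie in the analysis window**:
for every hole doping `δ ∈ [0.10, 0.35]` the chemical potential of the nearest-neighbour band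
`ε₀ = squareDispersion 1 0` at density `1 - δ`,
`μ(δ) = chemicalPotentialOfDensity ε₀ (1 - δ) = sInf {μ | 1 - δ ≤ n(μ)}` (`KohnLuttinger.lean`), lies in
`[-1, -0.15]`.  This is the registered stub `stub_muWindow` of both crux skeletons of the route
(`H10TwoPointLimit_of`, `KLRegimeTwoPointLimit_of`), letting the analysis work in the
`μ`-parametrisation.

Proof (`muOfDopingWindow_proof`, type spelled out structurally = the route decl
`Summit.HubbardSuperconductivity.HubbardSuperconductivity.Theses.KLProgramme.MuOfDopingWindow`):
the filling `n` is monotone (`monotone_filling`), and the two CERTIFIED quadratures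

* `muWinU_filling_lt : n(-1) < 13/20` (octagon circumscribing the Fermi sea, `…FillingUpper.lean`),
* `muWinL_filling_ge : 9/10 ≤ n(-3/20)` (24-gon inscribed in the convex Fermi sea, `…FillingLower.lean`)

give: every admissible `μ` (`1 - δ ≤ n(μ)`, with `1 - δ ≥ 13/20`) is `≥ -1`, and `-0.15` is admissible
(`1 - δ ≤ 9/10 ≤ n(-0.15)`); hence `-1 ≤ sInf ≤ -0.15` (`le_csInf` / `csInf_le`).  Folklore; no definitions;
this module does not import the route file (the gate links `MuOfDopingWindow_holds`).
-/

noncomputable section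

set_option linter.dupNamespace false

namespace Summit.HubbardSuperconductivity.HubbardSuperconductivity.Theorems

open Literature.MathematicalPhysics.QuantumLattice

/-- **Item `MuOfDopingWindow` (S0 of route `KLProgramme`)**: `μ(δ) ∈ [-1, -0.15]` for every
`δ ∈ [0.10, 0.35]`, where `μ(δ) = sInf {μ | 1 - δ ≤ n(μ)}` is the free-band chemical potential of the
square-lattice dispersion at density `1 - δ` (two certified fillings `n(-1) < 13/20`, `n(-3/20) ≥ 9/10`,
monotonicity of `n`, and the `sInf` characterisation). [folklore] -/
theorem muOfDopingWindow_proof :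
    ∀ δ ∈ Set.Icc (0.10 : ℝ) 0.35, Literature.MathematicalPhysics.QuantumLattice.chemicalPotentialOfDensity (Literature.MathematicalPhysics.QuantumLattice.squareDispersion 1 0) (1 - δ) ∈ Set.Icc (-1 : ℝ) (-0.15) := by
  intro δ hδ
  obtain ⟨hδ1, hδ2⟩ := hδ
  set S : Set ℝ := {μ | 1 - δ ≤ KohnLuttinger.filling (squareDispersion 1 0) μ} with hS
  have hdef : chemicalPotentialOfDensity (squareDispersion 1 0) (1 - δ) = sInf S := rfl
  -- every admissible chemical potential is `≥ -1`
  have hlow : ∀ μ ∈ S, -1 ≤ μ := by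
    intro μ hμ
    by_contra h
    push Not at h
    have hmono := monotone_filling h.le
    have hlt := muWinU_filling_lt
    have hμ' : 1 - δ ≤ KohnLuttinger.filling (squareDispersion 1 0) μ := hμ
    norm_num at hδ2
    linarith
  -- the energy `-0.15 = -3/20` is admissible
  have hmem : (-0.15 : ℝ) ∈ S := by
    show 1 - δ ≤ KohnLuttinger.filling (squareDispersion 1 0) (-0.15)
    have h := muWinL_filling_ge
    rw [show (-(3 : ℝ) / 20) = -0.15 by norm_num] at h
    norm_num at hδ1
    linarith
  rw [hdef]
  exact ⟨le_csInf ⟨_, hmem⟩ hlow, csInf_le ⟨-1, hlow⟩ hmem⟩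

end Summit.HubbardSuperconductivity.HubbardSuperconductivity.Theorems

end
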